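import Literature.Topology.FourManifolds.SPC4Handles
import Literature.Topology.FourManifolds.ClosedBallHandles
import Literature.Topology.FourManifolds.CerfGammaFourProofs
import Literature.Topology.FourManifolds.GluingProofs
import HarnessLib

/-!
# The Laudenbach–Poénaru extension fact contains Cerf's `Γ₄ = 0` (the case of no `1`-handles)

Topic `Literature/Topology/FourManifolds`; review seat of the named fact
`Literature.Topology.FourManifolds.exists_diffeomorph_comp_incl_eq` (**spc4.S24 (c)**,
`SPC4Handles.lean`: every self-diffeomorphism of the boundary `#k S¹ × S²` of a compact
connected orientable smooth `4`-dimensional `1`-handlebody `V ≅ ♮k S¹ × B³` extends over `V`;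
Laudenbach–Poénaru, Bull. SMF 100 (1972), proof of Thm. A, p. 342, "mark that no
diffeomorphism of `X_p` was needed here!"; quoted in this extension form by Kirby, *The
topology of 4-manifolds* (1989), Ch. I §2, p. 8: "any such diffeomorphism extends over
`♮k S¹ × B³` [L-P]").  Everything here is **proved**; no named fact is introduced.

The first theorem of this file is a machine-checked *size certificate* for that fact: its
instance `k = 0` — the closed ball `𝔻⁴`, which is a compact connected orientable
`1`-handlebody with no `1`-handle (`isHandlebodyOfIndexLE_closedBall`,
`isOrientable_closedBall`, `ClosedBallHandles.lean`), with boundary datum the unit sphere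
`𝕊³ ↪ 𝔻⁴` (`closedBallBoundaryData 3`, `ClosedBall.lean`) — is *literally* Cerf's theorem
`Γ₄ = 0` in extension form, the tree's named fact
`Literature.Topology.FourManifolds.cerf_diffeomorph_sphere_three_extends_ball`
(`CerfGammaFourProofs.lean`; Cerf, LNM 53 (1968), Ch. I §1, Théorème 1 with Corollaire 1:
every self-diffeomorphism of `S³` extends to a self-diffeomorphism of `D⁴`).  This is as it
must be: Laudenbach–Poénaru's proof (p. 342) invokes Laudenbach, *Sur les 2-sphères d'une
variété de dimension 3*, Ann. of Math. 97 (1973), §5 (5.3–5.4), whose description of the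
diffeomorphisms of `#p S¹ × S²` up to isotopy rests on Cerf's `Γ₄ = 0`; for `p = 0` Thm. A
reads `D⁴ ∪_h D⁴ ≅ S⁴` for every `h`, i.e. `Γ₄ = 0`.  Consequently a discharge
`exists_diffeomorph_comp_incl_eq_holds` would in particular discharge
`cerf_diffeomorph_sphere_three_extends_ball` (and with it `cerf_twistedSphere_four`,
`cerf_twistedSphere_four_of_extends`), and the fact is at least as hard to formalise as Cerf's
monograph (xii + 133 pp.; reproved through Hatcher's `Diff(S³) ≃ O(4)` (1983) or
Eliashberg's filling by holomorphic discs (1992)).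

* `cerf_diffeomorph_sphere_three_extends_ball_of_exists_diffeomorph_comp_incl_eq`:
  `exists_diffeomorph_comp_incl_eq.{0} → cerf_diffeomorph_sphere_three_extends_ball`.
* `cerf_twistedSphere_four_of_exists_diffeomorph_comp_incl_eq` (appended 2026-08-16):
  `exists_diffeomorph_comp_incl_eq.{0} → cerf_twistedSphere_four`, through the proved reduction
  `cerf_twistedSphere_four_of_extends'` and the proved uniqueness of gluings — so a consumer
  holding the Laudenbach–Poénaru fact needs no separate Cerf hypothesis.

## References

* F. Laudenbach, V. Poénaru, *A note on 4-dimensional handlebodies*, Bull. Soc. Math. France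
  100 (1972), 337–344: Thm. A (p. 337) and its proof, §2, pp. 341–342.  Held:
  `lit read doi-10-24033-bsmf-1741`. [LaudenbachPoenaruBSMF1972]
* J. Cerf, *Sur les difféomorphismes de la sphère de dimension trois (Γ₄ = 0)*, Lecture Notes
  in Math. 53, Springer (1968): Introduction and Ch. I §1, Théorème 1, Corollaire 1. [Cerf1968]
* R. C. Kirby, *The topology of 4-manifolds*, Lecture Notes in Math. 1374, Springer (1989),
  Ch. I §2, p. 8.  Held: `book:kirby1989-topology-4-manifolds`, p. 8.
-/

open scoped Manifold ContDiff
open Set Function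

noncomputable section

namespace Literature.Topology.FourManifolds

/-- **The Laudenbach–Poénaru extension fact at `k = 0` is Cerf's `Γ₄ = 0`.**  If every
self-diffeomorphism of the boundary of every compact connected orientable `4`-dimensional
`1`-handlebody extends over it (`exists_diffeomorph_comp_incl_eq`, Laudenbach–Poénaru (1972),
proof of Thm. A, p. 342; Kirby (1989), Ch. I §2, p. 8), then every self-diffeomorphism of
`S³ = ∂D⁴` extends to a self-diffeomorphism of `D⁴`
(`cerf_diffeomorph_sphere_three_extends_ball`; Cerf (1968), Ch. I §1, Théorème 1 with
Corollaire 1): apply the fact to `V = 𝔻⁴` — one `0`-handle and no `1`-handle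
(`isHandlebodyOfIndexLE_closedBall`), connected (`connectedSpace_closedBall`), orientable
(`isOrientable_closedBall`) — with the boundary datum `closedBallBoundaryData 3`, whose carrier
is `𝕊³` and whose inclusion is `Set.inclusion` (both definitional), the smooth-embedding field
being the proved `isSmoothEmbedding_sphereInclusion'_holds`.
[cite: LaudenbachPoenaruBSMF1972, §2, proof of Thm. A, p. 342 (case p = 0)]
[cite: Cerf1968, Ch. I §1, Théorème 1 with Corollaire 1 (Γ₄ = 0)] -/
theorem cerf_diffeomorph_sphere_three_extends_ball_of_exists_diffeomorph_comp_incl_eq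
    (h : exists_diffeomorph_comp_incl_eq.{0}) : cerf_diffeomorph_sphere_three_extends_ball := by
  intro φ
  haveI : Fact (isSmoothEmbedding_sphereInclusion' 3) := ⟨isSmoothEmbedding_sphereInclusion'_holds 3⟩
  haveI : ConnectedSpace (Metric.closedBall (0 : EuclideanSpace ℝ (Fin 4)) 1) :=
    connectedSpace_closedBall 3
  obtain ⟨Φ, hΦ⟩ := h (Metric.closedBall (0 : EuclideanSpace ℝ (Fin 4)) 1)
    (isHandlebodyOfIndexLE_closedBall 3 1) (isOrientable_closedBall 3) (closedBallBoundaryData 3) φ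
  exact ⟨Φ, fun z => congrFun hΦ z⟩

/-- **Hence the Laudenbach–Poénaru extension fact contains Cerf's theorem in twisted-sphere
form: `exists_diffeomorph_comp_incl_eq.{0} → cerf_twistedSphere_four`.**  Combine the `k = 0`
instance above (every self-diffeomorphism of `S³` extends over `D⁴`) with the PROVED reduction
`cerf_twistedSphere_four_of_extends'` (`CerfGammaFourProofs.lean`: the extension form plus
uniqueness of the gluings `D⁴ ∪_φ D⁴`, the latter being the theorem
`nonempty_diffeomorph_of_isBoundaryGluing_closedBall_of_isManifold`, `GluingProofs.lean`).
Consequence for the consumers that take BOTH named facts as hypotheses — the Property-R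
endgames of the `SmoothPoincare4` cruxes, `(hC : cerf_twistedSphere_four)` next to
`(hLP : exists_diffeomorph_comp_incl_eq.{0})` —: the hypothesis `hC` is redundant,
`hC := cerf_twistedSphere_four_of_exists_diffeomorph_comp_incl_eq hLP`; a debt list
`{Cerf, Laudenbach–Poénaru, …}` is the debt list `{Laudenbach–Poénaru, …}`.
[cite: LaudenbachPoenaruBSMF1972, §2, proof of Thm. A, p. 342 (case p = 0)]
[cite: Cerf1968, Summary by N. H. Kuiper (front matter), 1st par. (Γ₄ = 0 ⇒ twisted spheres are standard)] -/
theorem cerf_twistedSphere_four_of_exists_diffeomorph_comp_incl_eq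
    (h : exists_diffeomorph_comp_incl_eq.{0}) : cerf_twistedSphere_four :=
  cerf_twistedSphere_four_of_extends'
    (cerf_diffeomorph_sphere_three_extends_ball_of_exists_diffeomorph_comp_incl_eq h)
    (fun _ _ _ _ => nonempty_diffeomorph_of_isBoundaryGluing_closedBall_of_isManifold)

end Literature.Topology.FourManifolds

end
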